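import Summits.AtomisticToContinuum.Crystallization.Theorems.ChargedEnergyGapStationCert
import Summits.AtomisticToContinuum.Crystallization.Theorems.ChargedEnergyGapAxisWLOG
import HarnessLib

/-!
# ChargedEnergyGap · NODE 112 «ChamberCert» — the station checker IN THE AXIS-ZERO CHAMBER: one cap block, boxes may cross the chamber wall (memo §19)

decomp-a2c lens-3 g92.  Imports lane NODE 110E «StationCert» (the station data, `check`, `sound`, `payload_sound`, `box_payload_sound`) and lane
NODE 111 «AxisWLOG» (`poleSum`, `chargeDepth_of_axisZero`, `stencilChartLawQ_of_axisZero`).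
WHY.  `StationCert.check` dispatches the cap over the THREE axes geometrically (108C `capCheck 0 1 2` through N106 `cap_at_chargeDepth`): an axis is
vacuous only if its low pole sum exceeds some high pole sum ON THE BOX, so a station box reaching the chamber wall `poleSum 0 = poleSum a` must carry a
real cap cell for axis `a` over a long t-range — measured: capLB 45.63 → 29.94 on the ridge core at transverse extent −0.75 (station 11, FAIL), although the
point margin there is the whole cap (cost 0 beyond −0.2, memo §19.2).  In the axis-zero chamber NODE 111 gives `chargeDepth ρ dt 0 = poleSum dt 0 / 2 + ρ`
for EVERY tuple, whatever the box (`chargeDepth_of_axisZero`); so a station whose tuples are taken in the chamber needs the AXIS-0 cap block only.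
CONTENT.  `chamberRows` = the FIVE normal-form rows of NODE 111 as station CUTS (door «110D″»: `x₁+x₂−x₃−x₄ ≤ 0`, `x₁+x₂−x₅−x₆ ≤ 0`, `x₁−x₂ ≤ 0`, `x₃−x₄ ≤ 0`,
`x₅−x₆ ≤ 0` in the 110D valuation `sval`, pool indices `|R.rows| … |R.rows|+4`), sound under the normal-form binders (`chamberRows_sound`);
`StationCert.checkCh` = `check` with the axis-1/2 cap checks dropped (station and leaf-local) and the pool `R.rows ++ chamberRows`;
★★★ `StationCert.sound_chamber`: `checkCh = true` ⇒ the (T¹ᶜ) inequality for every `ρ ∈ [rho0, rho1]` and every chart-realisable positive tuple of the box in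
the FULL NORMAL FORM `poleSum dt 0 ≤ poleSum dt 1`, `poleSum dt 0 ≤ poleSum dt 2`, `∀ a, dt (a,true)-pole ≤ dt (a,false)-pole` — exactly the binders of
`stencilChartLawQ_of_fullNormalForm` (÷48), so chamber stations compose with the WLOG of NODE 111 to (T¹ᶜ); the station of record (FD) is such a station.
The same `StationCert` literal serves both checkers (blocks `cap 1`, `cap 2` are ignored here; emitter knob `JOB_CHAMBER=1` appends the five rows to its pool).
[SPLIT beneath (T¹ᶜ) ∘ NODE 111 (no EQUIV introduced) · UNDECIDED(test = (D¹)) unchanged.] -/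

namespace Summit.AtomisticToContinuum.Crystallization.Theorems.ChargedEnergyGapChartDial

/-- ★ Door «110D″»: the five normal-form rows of NODE 111 as cuts, in the valuation `sval` of 110D (coordinates `1 … 6` = the six hole-vertex depths). -/
def chamberRows : List LRow :=
  [⟨[0, 1, 1, -1, -1], 0⟩, ⟨[0, 1, 1, 0, 0, -1, -1], 0⟩, ⟨[0, 1, -1], 0⟩, ⟨[0, 0, 0, 1, -1], 0⟩, ⟨[0, 0, 0, 0, 0, 1, -1], 0⟩]

/-- ★ The chamber rows hold at every tuple in the full normal form of NODE 111. -/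
theorem chamberRows_sound (dt : (Fin 3 → ℤ) → ℝ) (h1 : poleSum dt 0 ≤ poleSum dt 1) (h2 : poleSum dt 0 ≤ poleSum dt 2)
    (hp : ∀ a : Fin 3, dt (holeVertex 0 (a, true)) ≤ dt (holeVertex 0 (a, false))) : ∀ r ∈ chamberRows, linAt r.a (sval dt) 0 ≤ (r.b : ℝ) := by
  have e1 : sval dt 1 = dt (holeVertex 0 (0, true)) := rfl
  have e2 : sval dt 2 = dt (holeVertex 0 (0, false)) := rfl
  have e3 : sval dt 3 = dt (holeVertex 0 (1, true)) := rfl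
  have e4 : sval dt 4 = dt (holeVertex 0 (1, false)) := rfl
  have e5 : sval dt 5 = dt (holeVertex 0 (2, true)) := rfl
  have e6 : sval dt 6 = dt (holeVertex 0 (2, false)) := rfl
  unfold poleSum at h1 h2
  have hp0 := hp 0; have hp1 := hp 1; have hp2 := hp 2
  simp only [chamberRows, List.mem_cons, List.not_mem_nil, or_false, forall_eq_or_imp, forall_eq, linAt_cons, linAt_nil, e1, e2, e3, e4, e5, e6]
  push_cast
  refine ⟨?_, ?_, ?_, ?_, ?_⟩ <;> linarith

/-- ★ THE CHAMBER CHECKER: `check` without the axis-`1`/`2` cap blocks and with the chamber rows in the pool. -/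
def StationCert.checkCh (c : StationCert) : Bool :=
  c.R.ok && decide (0 < c.R.rho0) && c.bases.all BasisCert.invCheck && c.boxes.all c.boxCheck && c.caps.all (fun l => (c.capCertL l).capCheck 0) &&
    c.capCert.capCheck 0 && c.tree.check c.need (c.R.rows ++ chamberRows)

/-- ★ The axis-0 cap block ALONE bounds the cap at the charge depth of every chamber tuple in the block's box (108C `capCheck_sound 0` + NODE 111
`chargeDepth_of_axisZero`). -/
theorem capCheck_zero_chamber {k : CostCellCert} (hk : k.capCheck 0 = true) {ρ : ℝ} (hρ : 0 < ρ) (h₀ : (k.rho0 : ℝ) ≤ ρ) (h₁ : ρ ≤ k.rho1)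
    {dt : (Fin 3 → ℤ) → ℝ} (hb : ∀ q, castW k.lo q ≤ dt (holeVertex 0 q) ∧ dt (holeVertex 0 q) ≤ castW k.hi q)
    (hc1 : poleSum dt 0 ≤ poleSum dt 1) (hc2 : poleSum dt 0 ≤ poleSum dt 2) :
    (k.capLB : ℝ) * k.u ≤ domCapK k.u 160 (3 / 100) ρ (chargeDepth ρ dt 0) := by
  rw [chargeDepth_of_axisZero hρ hc1 hc2]
  have hle : ∀ b : Fin 3, poleSum dt 0 ≤ poleSum dt b := fun b => by
    fin_cases b
    · exact le_rfl
    · exact hc1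
    · exact hc2
  refine k.capCheck_sound 0 hk (fun b => ?_) ρ _ h₀ h₁ ?_ ?_
  · have h := hle b
    unfold poleSum at h
    linarith [(hb (0, true)).1, (hb (0, false)).1, (hb (b, true)).2, (hb (b, false)).2]
  · unfold poleSum; linarith [(hb (0, true)).1, (hb (0, false)).1]
  · unfold poleSum; linarith [(hb (0, true)).2, (hb (0, false)).2]

/-- ★★★ **SOUNDNESS IN THE CHAMBER**: `checkCh = true` ⇒ the (T¹ᶜ) inequality for every `ρ ∈ [rho0, rho1]` and every chart-realisable positive tuple of
the station box lying in the axis-zero chamber. -/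
theorem StationCert.sound_chamber (c : StationCert) (h : c.checkCh = true) :
    ∀ ρ : ℝ, (c.R.rho0 : ℝ) ≤ ρ → ρ ≤ c.R.rho1 → ∀ dt : (Fin 3 → ℤ) → ℝ,
      (∀ q, castW c.R.lo q ≤ dt (holeVertex 0 q) ∧ dt (holeVertex 0 q) ≤ castW c.R.hi q) → ((c.R.loC : ℝ) ≤ dt 0 ∧ dt 0 ≤ c.R.hiC) →
      IsChartRealisable ρ dt → (∀ p ∈ stencil 0, 0 < dt p) → poleSum dt 0 ≤ poleSum dt 1 → poleSum dt 0 ≤ poleSum dt 2 →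
      (∀ a : Fin 3, dt (holeVertex 0 (a, true)) ≤ dt (holeVertex 0 (a, false))) →
      feetHoleCost 160 (3 / 100) ρ dt 0 ≤ domCapK c.u 160 (3 / 100) ρ (chargeDepth ρ dt 0) := by
  simp only [StationCert.checkCh, Bool.and_eq_true, decide_eq_true_eq, List.all_eq_true] at h
  obtain ⟨⟨⟨⟨⟨⟨hok, hρ0⟩, hbases⟩, hboxes⟩, hcaps⟩, hc0⟩, htree⟩ := h
  intro ρ h₀ h₁ dt hbox hC hreal hpos hch1 hch2 hchp
  have hρ : 0 < ρ := lt_of_lt_of_le (by exact_mod_cast hρ0) h₀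
  have hbox' : ∀ q, (c.R.lo q : ℝ) ≤ dt (holeVertex 0 q) ∧ dt (holeVertex 0 q) ≤ c.R.hi q := fun q => by simpa [castW_apply] using hbox q
  have hrows : ∀ r ∈ c.R.rows ++ chamberRows, linAt r.a (sval dt) 0 ≤ (r.b : ℝ) := fun r hr => by
    rcases List.mem_append.1 hr with hr | hr
    · exact c.R.rows_sound hok h₀ h₁ hbox' hC hreal hpos r hr
    · exact chamberRows_sound dt hch1 hch2 hchp r hr
  have hcost := feetHoleCost_le_of_roofVal_le (ϱ := 160) (d := dt) (w := 0) (show (0 : ℝ) ≤ 3 / 100 by norm_num) hρ.le h₁ le_rfl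
  -- the finishing move in the chamber: shell `k` with its axis-0 cap check and `dt` in its box
  have finish : ∀ (k : CostCellCert), k.rho0 = c.R.rho0 → k.rho1 = c.R.rho1 → k.u = c.u → k.capCheck 0 = true →
      (∀ q, castW k.lo q ≤ dt (holeVertex 0 q) ∧ dt (holeVertex 0 q) ≤ castW k.hi q) →
      (3 / 100 * (2 * (c.R.rho1 : ℝ))) ^ 2 * roofVal T75 (vtxW 160 dt 0) ≤ (k.capLB : ℝ) * c.u →
      feetHoleCost 160 (3 / 100) ρ dt 0 ≤ domCapK c.u 160 (3 / 100) ρ (chargeDepth ρ dt 0) := by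
    intro k e0 e1 eu k0 hb hpay
    have hdom := capCheck_zero_chamber k0 hρ (e0 ▸ h₀ :) (e1 ▸ h₁ :) hb hch1 hch2
    rw [eu] at hdom
    exact hcost.trans (hpay.trans hdom)
  obtain ⟨π, hπ⟩ := c.tree.sound c.need (sval dt) (c.R.rows ++ chamberRows) htree hrows
  cases π with
  | cone j =>
    simp only [StationCert.need] at hπ
    split at hπ
    · exact absurd hπ (not_nilRow _)
    · next B hB => exact finish c.capCert rfl rfl rfl hc0 hbox (c.payload_sound (hbases B (List.mem_of_getElem? hB)) dt hπ)
  | box j =>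
    simp only [StationCert.need] at hπ
    split at hπ
    · exact absurd hπ (not_nilRow _)
    · next b hb =>
      obtain ⟨hbc, hv⟩ := Bool.and_eq_true_iff.1 (hboxes b (List.mem_of_getElem? hb))
      exact finish c.capCert rfl rfl rfl hc0 hbox (c.box_payload_sound hbc (qle (of_decide_eq_true hv)) dt hπ)
  | coneL j k =>
    simp only [StationCert.need] at hπ
    split at hπ
    · next B l hB hl =>
      exact finish (c.capCertL l) rfl rfl rfl (hcaps l (List.mem_of_getElem? hl)) (l.box_of_need dt fun r hr => hπ r (List.mem_append_right _ hr))
        (c.payload_sound (hbases B (List.mem_of_getElem? hB)) dt fun r hr => hπ r (List.mem_append_left _ hr))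
    · exact absurd hπ (not_nilRow _)
  | boxL j k =>
    simp only [StationCert.need] at hπ
    split at hπ
    · next b l hb hl =>
      obtain ⟨hbc, -⟩ := Bool.and_eq_true_iff.1 (hboxes b (List.mem_of_getElem? hb))
      have hv : (0 : ℝ) ≤ ((l.capLB * c.u - c.kfac * b.R : ℚ) : ℝ) := by
        simpa [linAt] using hπ _ (List.mem_append_right _ (List.mem_singleton.2 rfl))
      refine finish (c.capCertL l) rfl rfl rfl (hcaps l (List.mem_of_getElem? hl))
        (l.box_of_need dt fun r hr => hπ r (List.mem_append_left _ (List.mem_append_right _ hr)))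
        (c.box_payload_sound hbc ?_ dt fun r hr => hπ r (List.mem_append_left _ (List.mem_append_left _ hr)))
      change ((c.kfac * b.R : ℚ) : ℝ) ≤ ((l.capLB * c.u : ℚ) : ℝ)
      push_cast at hv ⊢
      linarith
    · exact absurd hπ (not_nilRow _)

/-- ★ Batch form. -/
theorem StationCert.sound_chamber_of_all {cs : List StationCert} (h : cs.all StationCert.checkCh = true) {c : StationCert} (hc : c ∈ cs) :
    ∀ ρ : ℝ, (c.R.rho0 : ℝ) ≤ ρ → ρ ≤ c.R.rho1 → ∀ dt : (Fin 3 → ℤ) → ℝ,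
      (∀ q, castW c.R.lo q ≤ dt (holeVertex 0 q) ∧ dt (holeVertex 0 q) ≤ castW c.R.hi q) → ((c.R.loC : ℝ) ≤ dt 0 ∧ dt 0 ≤ c.R.hiC) →
      IsChartRealisable ρ dt → (∀ p ∈ stencil 0, 0 < dt p) → poleSum dt 0 ≤ poleSum dt 1 → poleSum dt 0 ≤ poleSum dt 2 →
      (∀ a : Fin 3, dt (holeVertex 0 (a, true)) ≤ dt (holeVertex 0 (a, false))) →
      feetHoleCost 160 (3 / 100) ρ dt 0 ≤ domCapK c.u 160 (3 / 100) ρ (chargeDepth ρ dt 0) :=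
  c.sound_chamber (List.all_eq_true.mp h c hc)

end Summit.AtomisticToContinuum.Crystallization.Theorems.ChargedEnergyGapChartDial
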